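import Summits.AtomisticToContinuum.FouriersLaw.Theses.EmbeddedDrudeMourre
import Summits.AtomisticToContinuum.FouriersLaw.Theorems.EmbeddedDrudeMourreDrudeDissolutionOfBmKineticCruxes
import Summits.AtomisticToContinuum.FouriersLaw.Theorems.EmbeddedDrudeMourreDrudeDissolutionStubBmRigidity
import Summits.AtomisticToContinuum.FouriersLaw.Theorems.EmbeddedDrudeMourreDrudeDissolutionIffMourre
import Summits.AtomisticToContinuum.FouriersLaw.Theorems.DrudeDissolution.Negative.WindowNotL1
import Summits.AtomisticToContinuum.FouriersLaw.Theorems.DrudeDissolution.Negative.SpectralPairNecessities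
import Literature.MathematicalPhysics.KineticTheory.InfiniteChainSuperstableDynamics
import HarnessLib

/-!
# Line `canonical-kinetic-cut` — checked skeleton v1 for the crux `EmbeddedDrudeMourre.MourreDissolution`
(stmt-AtomisticToContinuum-12594, rank-2 crux of route `route-AtomisticToContinuum-EmbeddedDrudeMourre`, sub-problem
`AtomisticToContinuum/FouriersLaw`; crux-strategist `planner-cstrat-stmt-AtomisticToContinuum-12594-p1-0`, wall-breaker pass 1,
2026-08-17; card `Lines/canonical-kinetic-cut.md`; census `STRATEGY-CENSUS.md`; split package `SPLIT-PACKAGE.md`)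

Crux (FIXED — the route decl, never restated): for `pinnedChain ω₂ lam β γ` (all four `> 0`), IF ALS's linearised phonon
Boltzmann form has an odd-sector gap (`HasOddSectorGap ω₂ lam β`, PROVED for all such parameters: `FGRGap_proof`) THEN there is
`T₀ > 0` such that for every `T ∈ (0, T₀)` some Gibbs state with a measure-preserving infinite-volume dynamics has summed current
autocorrelation `C_T(t) = ∫ cos(ωt) dσ(ω)` for a finite `σ` carrying, on a window `(−δ, δ)`, a continuous density `g ≥ 0` with
`g 0 > 0`.

## What this line is (one paragraph)

THE DECOMPOSITION CARRIER. Sixteen leads and three checked Mourre-dress skeletons (all documented dead, `Lines/*-dead.md`)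
reduced the crux to one residue: `t = ∞` control of the CANONICAL `C_T` (Buttà–Marchioro flow on `bmGood`, the unique
shift-invariant DLR state) at fixed small `T`. The only typed cut of that residue into two GENUINE pieces with proved glue is
the kinetic one, in the crux's own existential currency: **PKT∃** `stub_bmPostKineticTail` — T-uniform smallness of the far
tail `∫_{M T⁻²}^∞ |C_T|` (the wall; ⊇ the regularity half (R): with the landed `StationaryCorrelationBound` it gives
`C_T ∈ L¹(0, ∞)`), and **KL∃** `stub_bmKineticLimit` — the wave-kinetic limit on every finite kinetic window `[δT⁻², MT⁻²]`
with `∫₀^∞ K > 0` (carries the positivity half (P) for free: the kinetic integral is ALS's inverse form, positive by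
`FGRGap_proof` + `kineticConductivityFinite_proof`). The composition `MourreDissolution_of : PKT∃ → KL∃ → MourreDissolution` is
sorry-free (landed ingredients: `stub_bmRigidity` p127446, `drudeDissolution_of_bmRigidity_of_bmPostKineticTail_of_bmKineticLimit`,
`mourreDissolution_of_drudeDissolution`). The two stub statements are VERBATIM the children `BmPostKineticTail` /
`BmKineticLimit` of the prepared split (`SPLIT-PACKAGE.md`): a lead that reaches its final cycle with both stubs open is
expected to TAKE THE HARNESS'S SPLIT OFFER with that package (this strategist's `route edit --split` was bounced
"final-cycle only"), turning the stubs into leaf sub-cruxes with their own chains. Until then the line hosts the first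
provable lemmas toward KL∃ listed in the card (`--supports stmt-AtomisticToContinuum-12594`).

## Relation to the dead lines and to the twin crux
* Not a Mourre/Feshbach dress: no conjugate operator, no LAP, no `∃ 𝒜` signature — so none of the deaths D1 (strict positive
  commutator at an infinitely degenerate threshold), D3 (memory-kernel topology), D4 (λ-series) applies; the wall D2
  (`t = ∞` at fixed `T`) is NOT dodged — it is ISOLATED into one named stub, PKT∃, stated about one canonical function.
* The twin crux `DrudeDissolution` (stmt-12593, proved equivalent: `drudeDissolution_iff_mourreDissolution`) carries the same
  two stubs in its line `Sketch` rev 12 (dead: blocked-on-open). This skeleton is its image on stmt-12594 with the purpose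
  stated above; the registered statements coincide token-for-token so that one split serves both cruxes.

## Disproof / Negative used
`Cruxes/MourreDissolution/Disproof.lean` v5 (rc 0; no `-- Targets`, no `stub_*_false`): §5 kill criterion (a Drude weight) is
PAID by PKT∃ (L¹ tail ⇒ Cesàro mean → 0); §2–§3 (γ not load-bearing; gap hypothesis scale-blind; ¬gap at the harmonic corner)
— irrelevant here (H is discharged by `FGRGap_proof` inside `mourreDissolution_of_drudeDissolution`'s converse direction; this
line never uses H). Twin `Negative` lemmas imported and checked against: `exists_window_not_integrable` (window ⇏ L¹: PKT∃ is
knowingly STRONGER than the crux's regularity clause — genuineness of the cut, not a refutation),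
`tendsto_cesaro_zero_of_window` / `atom_eq_zero_of_window` (no odd Drude atom is NECESSARY — consistent with PKT∃).
-/

noncomputable section

open MeasureTheory Filter Set Function
open scoped Topology

namespace Summit.AtomisticToContinuum.FouriersLaw.Cruxes.MourreDissolution.CanonicalKineticCut

/-! ## §1 Registered stubs (`sorry` only here; every signature self-contained over tree declarations; the two bodies are
VERBATIM the split children `BmPostKineticTail` / `BmKineticLimit` of `SPLIT-PACKAGE.md`) -/

/-- **PKT∃ `stub_bmPostKineticTail` — POST-KINETIC TAIL, EXISTENTIAL BUTTÀ–MARCHIORO FORM (the wall; research-open).**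
For every `e > 0` there are `M, T₀ > 0` such that for every `T ∈ (0, T₀)` SOME pair `(μ, D)` — `μ` a DLR state of
`pinnedChain ω₂ lam β γ` at `T` invariant under the unit shift, `D` an infinite-volume dynamics with carrier `bmGood`
preserving `μ` (canonical by `stub_bmRigidity`) — has `C_T ∈ L¹(M T⁻², ∞)` with `∫_{M T⁻²}^∞ |C_T| ≤ e`.
Implied by `KineticCorner.PostKineticTail` (stmt-3430; `bmPostKineticTail_of_postKineticTail`, landed). Size: open-problem
(`t = ∞` decorrelation of a deterministic interacting infinite lattice at fixed coupling is proved nowhere).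
[AokiLukkarinenSpohn2006; Lukkarinen2016; BonettoLebowitzReyBellet2000 §7] -/
theorem stub_bmPostKineticTail :
    ∀ ω₂ lam β γ : ℝ, 0 < ω₂ → 0 < lam → 0 < β → 0 < γ → ∀ e : ℝ, 0 < e →
      ∃ M T₀ : ℝ, 0 < M ∧ 0 < T₀ ∧ ∀ T : ℝ, 0 < T → T < T₀ →
        ∃ (μ : MeasureTheory.Measure Literature.MathematicalPhysics.KineticTheory.HeatConduction.ChainConfig)
          (D : Literature.MathematicalPhysics.KineticTheory.HeatConduction.InfiniteChainDynamics (Literature.MathematicalPhysics.KineticTheory.HeatConduction.pinnedChain ω₂ lam β γ)),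
          (Literature.MathematicalPhysics.KineticTheory.HeatConduction.pinnedChain ω₂ lam β γ).IsChainGibbsMeasure T μ ∧
          MeasureTheory.MeasurePreserving (fun σ : Literature.MathematicalPhysics.KineticTheory.HeatConduction.ChainConfig => fun i : ℤ => σ (i + 1)) μ μ ∧
          D.carrier = (Literature.MathematicalPhysics.KineticTheory.HeatConduction.pinnedChain ω₂ lam β γ).bmGood ∧ D.PreservesMeasure μ ∧
          MeasureTheory.IntegrableOn (D.currentCorrelation μ) (Set.Ioi (M / T ^ 2)) ∧
          ∫ t in Set.Ioi (M / T ^ 2), |D.currentCorrelation μ t| ≤ e := by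
  sorry

/-- **KL∃ `stub_bmKineticLimit` — WAVE-KINETIC LIMIT ON EVERY KINETIC WINDOW, EXISTENTIAL BUTTÀ–MARCHIORO FORM
(research-level, has proof SHAPE).** There is `K ∈ L¹(0, ∞)` with `∫₀^∞ K > 0` such that for all `0 < δ ≤ M`, `e > 0`
there is `T₀ > 0` with, for every `T ∈ (0, T₀)`, SOME pair `(μ, D)` as above having
`|∫_{δT⁻²}^{MT⁻²} C_T − ∫_δ^M K| ≤ e`. Content: `K(τ) = ⟨v, e^{−τL} v⟩` for the linearised 2↔2 collision operator of the
PINNED band; `∫K = inverse form > 0` is in the tree (`FGRGap_proof`, `kineticConductivityFinite_proof`); the threshold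
dictionary is landed (`fermiGoldenRule_threshold`, `freeLevelShift_threshold`, `boltzmannForm_lt_top_of_contDiff_two`,
`dispersion_three_one_gap`). Open: the window convergence for the thermal lattice with quartic Gibbs data in `d = 1`
(LukkarinenSpohn2010 needs `d ≥ 4`; no template). Implied by `KineticCorner.KineticLimit` (stmt-3431;
`bmKineticLimit_of_kineticLimit`, landed). [AokiLukkarinenSpohn2006 §3; LukkarinenSpohn2010; DengHani2023] -/
theorem stub_bmKineticLimit :
    ∀ ω₂ lam β γ : ℝ, 0 < ω₂ → 0 < lam → 0 < β → 0 < γ →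
      ∃ K : ℝ → ℝ, MeasureTheory.IntegrableOn K (Set.Ioi 0) ∧ 0 < ∫ τ in Set.Ioi 0, K τ ∧
        ∀ δ M e : ℝ, 0 < δ → δ ≤ M → 0 < e → ∃ T₀ : ℝ, 0 < T₀ ∧ ∀ T : ℝ, 0 < T → T < T₀ →
        ∃ (μ : MeasureTheory.Measure Literature.MathematicalPhysics.KineticTheory.HeatConduction.ChainConfig)
          (D : Literature.MathematicalPhysics.KineticTheory.HeatConduction.InfiniteChainDynamics (Literature.MathematicalPhysics.KineticTheory.HeatConduction.pinnedChain ω₂ lam β γ)),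
          (Literature.MathematicalPhysics.KineticTheory.HeatConduction.pinnedChain ω₂ lam β γ).IsChainGibbsMeasure T μ ∧
          MeasureTheory.MeasurePreserving (fun σ : Literature.MathematicalPhysics.KineticTheory.HeatConduction.ChainConfig => fun i : ℤ => σ (i + 1)) μ μ ∧
          D.carrier = (Literature.MathematicalPhysics.KineticTheory.HeatConduction.pinnedChain ω₂ lam β γ).bmGood ∧ D.PreservesMeasure μ ∧
          |(∫ t in (δ / T ^ 2)..(M / T ^ 2), D.currentCorrelation μ t) - ∫ τ in δ..M, K τ| ≤ e := by
  sorry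

/-! ## §2 The composition — the two stub statements conclude the crux BY NAME (kernel-checked, no `sorry`) -/

/-- **`MourreDissolution_of : PKT∃ → KL∃ → MourreDissolution`.** Rigidity of the BM class (`stub_bmRigidity`, landed
p127446) makes the witnesses of PKT∃ / KL∃ at each `T` share the canonical `C_T`; the landed
`drudeDissolution_of_bmRigidity_of_bmPostKineticTail_of_bmKineticLimit` (canonical datum + `StationaryCorrelationBound`
stmt-3435 + dominated tiling + cosine Bochner + integrable-spectral criterion) gives `DrudeDissolution`; weakening
(`mourreDissolution_of_drudeDissolution`) gives the crux. (= `mourreDissolution_of_subs` of the split certificate,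
evidence #86.) [folklore] -/
theorem MourreDissolution_of :
    (∀ ω₂ lam β γ : ℝ, 0 < ω₂ → 0 < lam → 0 < β → 0 < γ → ∀ e : ℝ, 0 < e →
      ∃ M T₀ : ℝ, 0 < M ∧ 0 < T₀ ∧ ∀ T : ℝ, 0 < T → T < T₀ →
        ∃ (μ : MeasureTheory.Measure Literature.MathematicalPhysics.KineticTheory.HeatConduction.ChainConfig)
          (D : Literature.MathematicalPhysics.KineticTheory.HeatConduction.InfiniteChainDynamics (Literature.MathematicalPhysics.KineticTheory.HeatConduction.pinnedChain ω₂ lam β γ)),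
          (Literature.MathematicalPhysics.KineticTheory.HeatConduction.pinnedChain ω₂ lam β γ).IsChainGibbsMeasure T μ ∧
          MeasureTheory.MeasurePreserving (fun σ : Literature.MathematicalPhysics.KineticTheory.HeatConduction.ChainConfig => fun i : ℤ => σ (i + 1)) μ μ ∧
          D.carrier = (Literature.MathematicalPhysics.KineticTheory.HeatConduction.pinnedChain ω₂ lam β γ).bmGood ∧ D.PreservesMeasure μ ∧
          MeasureTheory.IntegrableOn (D.currentCorrelation μ) (Set.Ioi (M / T ^ 2)) ∧
          ∫ t in Set.Ioi (M / T ^ 2), |D.currentCorrelation μ t| ≤ e) →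
    (∀ ω₂ lam β γ : ℝ, 0 < ω₂ → 0 < lam → 0 < β → 0 < γ →
      ∃ K : ℝ → ℝ, MeasureTheory.IntegrableOn K (Set.Ioi 0) ∧ 0 < ∫ τ in Set.Ioi 0, K τ ∧
        ∀ δ M e : ℝ, 0 < δ → δ ≤ M → 0 < e → ∃ T₀ : ℝ, 0 < T₀ ∧ ∀ T : ℝ, 0 < T → T < T₀ →
        ∃ (μ : MeasureTheory.Measure Literature.MathematicalPhysics.KineticTheory.HeatConduction.ChainConfig)
          (D : Literature.MathematicalPhysics.KineticTheory.HeatConduction.InfiniteChainDynamics (Literature.MathematicalPhysics.KineticTheory.HeatConduction.pinnedChain ω₂ lam β γ)),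
          (Literature.MathematicalPhysics.KineticTheory.HeatConduction.pinnedChain ω₂ lam β γ).IsChainGibbsMeasure T μ ∧
          MeasureTheory.MeasurePreserving (fun σ : Literature.MathematicalPhysics.KineticTheory.HeatConduction.ChainConfig => fun i : ℤ => σ (i + 1)) μ μ ∧
          D.carrier = (Literature.MathematicalPhysics.KineticTheory.HeatConduction.pinnedChain ω₂ lam β γ).bmGood ∧ D.PreservesMeasure μ ∧
          |(∫ t in (δ / T ^ 2)..(M / T ^ 2), D.currentCorrelation μ t) - ∫ τ in δ..M, K τ| ≤ e) →
    Summit.AtomisticToContinuum.FouriersLaw.Theses.EmbeddedDrudeMourre.MourreDissolution :=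
  fun hPKT hKL =>
    Summit.AtomisticToContinuum.FouriersLaw.Theorems.DrudeDissolution.mourreDissolution_of_drudeDissolution
      (Summit.AtomisticToContinuum.FouriersLaw.Theorems.DrudeDissolution.LineSketch.drudeDissolution_of_bmRigidity_of_bmPostKineticTail_of_bmKineticLimit
        Summit.AtomisticToContinuum.FouriersLaw.Theorems.DrudeDissolution.LineSketch.stub_bmRigidity hPKT hKL)

/-- The crux from the registered stubs (modulo their `sorry`s). -/
theorem mourreDissolution_of_stubs :
    Summit.AtomisticToContinuum.FouriersLaw.Theses.EmbeddedDrudeMourre.MourreDissolution :=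
  MourreDissolution_of stub_bmPostKineticTail stub_bmKineticLimit

/-! ## §3 Closure paths kept in view (all LANDED; nothing to prove here)
* `KineticCorner.PostKineticTail → PKT∃` and `KineticCorner.KineticLimit → KL∃`
  (`Theorems.DrudeDissolution.LineSketch.bmPostKineticTail_of_postKineticTail`, `…bmKineticLimit_of_kineticLimit`):
  closing stmt-3430 ∧ stmt-3431 closes both stubs. -/

example : Summit.AtomisticToContinuum.FouriersLaw.Theses.KineticCorner.PostKineticTail → (∀ ω₂ lam β γ : ℝ, 0 < ω₂ → 0 < lam → 0 < β → 0 < γ → ∀ e : ℝ, 0 < e →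
      ∃ M T₀ : ℝ, 0 < M ∧ 0 < T₀ ∧ ∀ T : ℝ, 0 < T → T < T₀ →
        ∃ (μ : MeasureTheory.Measure Literature.MathematicalPhysics.KineticTheory.HeatConduction.ChainConfig)
          (D : Literature.MathematicalPhysics.KineticTheory.HeatConduction.InfiniteChainDynamics (Literature.MathematicalPhysics.KineticTheory.HeatConduction.pinnedChain ω₂ lam β γ)),
          (Literature.MathematicalPhysics.KineticTheory.HeatConduction.pinnedChain ω₂ lam β γ).IsChainGibbsMeasure T μ ∧
          MeasureTheory.MeasurePreserving (fun σ : Literature.MathematicalPhysics.KineticTheory.HeatConduction.ChainConfig => fun i : ℤ => σ (i + 1)) μ μ ∧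
          D.carrier = (Literature.MathematicalPhysics.KineticTheory.HeatConduction.pinnedChain ω₂ lam β γ).bmGood ∧ D.PreservesMeasure μ ∧
          MeasureTheory.IntegrableOn (D.currentCorrelation μ) (Set.Ioi (M / T ^ 2)) ∧
          ∫ t in Set.Ioi (M / T ^ 2), |D.currentCorrelation μ t| ≤ e) :=
  Summit.AtomisticToContinuum.FouriersLaw.Theorems.DrudeDissolution.LineSketch.bmPostKineticTail_of_postKineticTail

example : Summit.AtomisticToContinuum.FouriersLaw.Theses.KineticCorner.KineticLimit → (∀ ω₂ lam β γ : ℝ, 0 < ω₂ → 0 < lam → 0 < β → 0 < γ →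
      ∃ K : ℝ → ℝ, MeasureTheory.IntegrableOn K (Set.Ioi 0) ∧ 0 < ∫ τ in Set.Ioi 0, K τ ∧
        ∀ δ M e : ℝ, 0 < δ → δ ≤ M → 0 < e → ∃ T₀ : ℝ, 0 < T₀ ∧ ∀ T : ℝ, 0 < T → T < T₀ →
        ∃ (μ : MeasureTheory.Measure Literature.MathematicalPhysics.KineticTheory.HeatConduction.ChainConfig)
          (D : Literature.MathematicalPhysics.KineticTheory.HeatConduction.InfiniteChainDynamics (Literature.MathematicalPhysics.KineticTheory.HeatConduction.pinnedChain ω₂ lam β γ)),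
          (Literature.MathematicalPhysics.KineticTheory.HeatConduction.pinnedChain ω₂ lam β γ).IsChainGibbsMeasure T μ ∧
          MeasureTheory.MeasurePreserving (fun σ : Literature.MathematicalPhysics.KineticTheory.HeatConduction.ChainConfig => fun i : ℤ => σ (i + 1)) μ μ ∧
          D.carrier = (Literature.MathematicalPhysics.KineticTheory.HeatConduction.pinnedChain ω₂ lam β γ).bmGood ∧ D.PreservesMeasure μ ∧
          |(∫ t in (δ / T ^ 2)..(M / T ^ 2), D.currentCorrelation μ t) - ∫ τ in δ..M, K τ| ≤ e) :=
  Summit.AtomisticToContinuum.FouriersLaw.Theorems.DrudeDissolution.LineSketch.bmKineticLimit_of_kineticLimit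

/-! ## §4 Genuineness checks against the twin's landed Negative lemmas (the cut is diagonal: PKT∃ is knowingly STRONGER than
the crux's window clause — a window does not give `L¹` — and "no atom at 0" is NECESSARY for the crux, consistent with PKT∃). -/

example := @Summit.AtomisticToContinuum.FouriersLaw.Theorems.DrudeDissolution.Negative.exists_window_not_integrable
example := @Summit.AtomisticToContinuum.FouriersLaw.Theorems.DrudeDissolution.Negative.tendsto_cesaro_zero_of_window

end Summit.AtomisticToContinuum.FouriersLaw.Cruxes.MourreDissolution.CanonicalKineticCut

end
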